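import Summits.BirchSwinnertonDyer.Rank1Residual.X11b.KolyvaginH44Concrete
import Summits.BirchSwinnertonDyer.Rank1Residual.X11b.KolyvaginPointClassFixed
import Summits.BirchSwinnertonDyer.Rank1Residual.X11b.RingClassFieldNoTorsion
import Summits.BirchSwinnertonDyer.Rank1Residual.X11b.RingClassFieldConj
import Summits.BirchSwinnertonDyer.Rank1Residual.X11b.KolyvaginConjugationDihedral
import HarnessLib

/-!
# Gross 1991 Prop. 5.4 (1) — `τ P_m ≡ ε_m P_m (mod p^M E(K_m))`, `ε_m = ε · (−1)^{f_m}` — for the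
# CONCRETE derived points `(d m).derivedPoint`: clause (d) of leaf (A′) at concrete currency,
# modulo Gross Prop. 5.3 at conductor `m` (A′-53) in its printed form

Cell `b2b-bsdres`, team x11b3 (N8/O2), `h44` / S15 programme; seat x11b3-p2 GEN 11 (offer
(P2-TAU-D), INBOX l.6657).  Summit-side THEOREM-ONLY file (no definition, no named fact, no
`sorry`); `K : Type` (the tree's ring-class class field theory is universe `0`); nothing is
`p`-specific (`p` any prime, any `M ≥ 1`).

HONEST FRAMING (binding): **plumbing at concrete currency.**  The tree's residual form of
Kolyvagin's finiteness theorem (`KolyvaginDescent.Kolyvagin1990_sha_primary_finite_of_pointsM_of_reciprocityM`)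
carries the leaf (A′) `hpoints`; its clause (d) at a Kolyvagin level `m` is Gross's Prop. 5.4 (1)
read in `E(K̄)`: `τ(P_m) = ε(−1)^{f_m} P_m + p^M B` with `B ∈ E(K_m)`.  The ALGEBRA of Prop. 5.4 (1)
is a tree theorem at abstract group-ring currency (`KolyvaginEuler.conj_kolyvaginPoint_sub_mem`,
consuming `hT` = the dihedral law, `hτy` = Prop. 5.3 and `htr` = Prop. 3.7 (1) + (3.3)).  THIS FILE
is the concrete-currency composition: for ANY family `d m : KolyvaginHeegnerData Dt β ι m` at the
divisors of a square-free Kolyvagin top level `n` (no coherence needed), EVERY lift `τ` to `K̄` of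
the non-trivial automorphism `c` of `K`, every `ε : ℤ` (FREE here; in Gross (5.2) `ε = ±1` is
the eigenvalue of the Fricke involution, `f|w_N = ε · f`, and the sign of the functional equation
is `−ε` — recorded, not proved, not used) and every `m ∣ n`:
`∃ B ∈ (d m).pointsSubgroup, τ · (d m).toGeomPoints (d m).derivedPoint =
(ε · (−1)^{#primeFactors m}) • (d m).toGeomPoints (d m).derivedPoint + p^M • B`, CONDITIONAL on
* `h53` = **(A′-53) = Gross 1991 Prop. 5.3 at conductor `m`, in its PRINTED form** (held
  `book:editornd-l-functions-arithmetic`, chunk 220 L11: *"We have `y_n^τ = ε · y_n^{σ'} +`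
  (torsion) in `E(K_n)`, for some `σ' ∈ 𝒢_n`"*): for the conjugation automorphism `τ_m` of
  `K[m] ⊂ ℂ` (`↑(τ_m x) = conj ↑x`) some `σ' ∈ 𝒢_m = Gal(K[m]/K)` has
  `τ_m y(m) − ε σ' y(m)` of finite order in `E(K[m])` — an OPEN LEAF of the cell (lead GEN 10
  R11-4 / R11-6), cite-only, NOT a Literature fact, NOT attempted, NOT discharged;
* `hA` — Gross Lemma 4.3 / McCallum (5): admissibility of `E(K[m]) ⊆ E(K̄)` for `p^M` (a tree
  theorem on both image cells: `RingClassNoTorsion.isAdmissible_pointsSubgroup_of_dvd`, consumed in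
  the `_of_surj` corollary; `NoTorsionIrr.…_of_hasIrreducibleModPGaloisRep_of_dvd` at `3 ∣ N`);
and structural data (`hND`, `hD : d_K < −4`, `hKol`, `hc : c ≠ 1`).  SUPPLIED from landed tree
theorems, following Gross's printed proof (chunk 220 L23 – chunk 221 L7): the dihedral law
`τ' σ τ'⁻¹ = σ⁻¹` on `𝒢_m` for `τ' ∉ 𝒢_m` (Gross §3 / §5, Cox Lemma 9.3; x11b3-p4
`Literature.….mul_mul_inv_eq_inv_of_not_mem_ringClassGal`) in its `hT` form (x11b3-p4
`KolyvaginConj.exists_addMonoidHom_map_smul_eq_inv_smul`, consumed BY NAME); the restriction `τ|K[m] = τ_m · h`, `h ∈ 𝒢_m`, and its coordinatewise action (x11b3-p8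
`RingClassConj.exists_mem_ringClassGal_apply_emb_eq` / `pointsMap_toGeomPoints_eq`); McCallum's (4)
`h P(m) ≡ P(m)` (x11b3-p4 `KolyvaginH44.smul_kolyvaginPoint_sub_mem_of_dvd`); `Tr_ℓ y(m) ∈ p^M E(K[m])`
((β2) `HeegnerTrace.sum_pow_pointGalHom_y_eq_lFunction_smul_map` + (3.3), x11b3-p4
`KolyvaginH44.grAct_traceElt_mem_of_dvd`); the level data and the G1 seam (x11b3-p2
`KolyvaginH44.exists_levelData`, x11b3-p8 `KolyvaginH37Bridge.map_kolyvaginPoint_eq_derivedPoint`);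
*"But Lemma 4.3 shows that `E(K_n)_p = 0`. Hence …"* (chunk 220 L37) = the folklore
`mem_zsmulRange_of_isOfFinAddOrder` below, fed by `hA`.  (A′-53) / (A′-glob) / (γ) / [GZ86 III (3.1)]
/ `h44` / `hpoints` / (R)_M are NOT discharged; nothing is booked; no mark / label / count / tier moves.

## What is proved

* `KolyvaginTauEigen.mem_zsmulRange_of_isOfFinAddOrder` — [folklore] in an additive commutative
  group without `q^M`-torsion (`q` prime, `M ≥ 1`) every element of finite order is a `q^M`-th
  multiple.
* **`KolyvaginTauEigen.pointsMap_derivedPoint_concrete_of_prop53`** — the END described above.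
* `KolyvaginTauEigen.pointsMap_derivedPoint_concrete_of_prop53_of_surj` — the same ON THE
  SURJECTIVE CELL (`ρ̄_{E,p}` onto, `p` odd; `hA` supplied by x11b3-p3): remaining labelled input
  exactly {`h53`} + the class binder + structural.

## References

* [GrossLMS1991] B. H. Gross, *Kolyvagin's work on modular elliptic curves*, in *L-functions and
  Arithmetic*, LMS LNS 153 (1991): §3 (`τστ⁻¹ = σ⁻¹`, (3.3), (3.5)), §4 (4.1), Lemma 4.3, §5
  Prop. 5.3, Prop. 5.4 (1) and its proof (held `book:editornd-l-functions-arithmetic`, chunks 216,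
  219, 220–221; chunk ids, not printed pages).
* [McCallumLMS1991] W. G. McCallum, *Kolyvagin's work on Shafarevich–Tate groups*, same volume,
  §4 (4)–(5).
* [Cox2013] D. A. Cox, *Primes of the form x² + ny²*, 2nd ed., §9.A Lemma 9.3 (the dihedral law).

presearch: [corpus:book:editornd-l-functions-arithmetic chunk 220 L11, L23–L37; chunk 221 L1–L7]
the statements quoted above = the printed result being COMPOSED (its algebra already PROVED in the
tree); `lit search --hybrid` → also [corpus:book:cornell1997-modular-forms-fermats-last-theorem
pp. 658–661] (exposition of Kolyvagin's method, background only); galaxy `"eigenspace for complex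
conjugation|Kolyvagin's derivative|y_n^\tau" --star all` → [galaxy:panama:195532681117774] the same
LMS volume, no second treatment; no fact minted.  `lean search 'KolyvaginTauEigen|_of_prop53'` → no
matches (INTENT-grep); `lean search` for the §1 folklore lemma (`mem_zsmulRange_of|IsOfFinAddOrder
… coprime`) → nearest is the curve-specific `nsmul_eq_zero_of_isOfFinAddOrder_of_coprime`
(`RationalPointRankTwoCriteria`), no general statement — proved here (15 lines).
-/

noncomputable section

open scoped Classical
open WeierstrassCurve Field NumberField IsDedekindDomain Finset
open Literature.NumberTheory.EllipticCurves Literature.NumberTheory.GaloisRepresentations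
open Literature.NumberTheory.EllipticCurves.KolyvaginCocycle Literature.NumberTheory.EllipticCurves.KolyvaginEuler
open Literature.NumberTheory.EllipticCurves.RingClassField Literature.NumberTheory.EllipticCurves.ModularForms

namespace Summit.BirchSwinnertonDyer.Rank1Residual.X11b.KolyvaginTauEigen

/-! ## §1 Torsion of order prime to `q` is `q^M`-divisible -/

section Torsion
variable {X : Type*} [AddCommGroup X]

/-- **In an additive commutative group without `q^M`-torsion every element of finite order is a
`q^M`-th multiple** (`q` prime, `M ≥ 1`): the order `k` of `t` is prime to `q` (else `(k/q) • t`
would be a non-zero `q`-torsion, hence `q^M`-torsion, element), and Bézout `u q^M + v k = 1` gives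
`t = q^M • (u • t)`.  Gross 1991, proof of Prop. 5.4 (1): *"`τ y_n = ε · σ'(y_n) +` torsion … But
Lemma 4.3 shows that `E(K_n)_p = 0`. Hence …"* (the torsion term is absorbed into `p E(K_n)`).
[folklore] -/
theorem mem_zsmulRange_of_isOfFinAddOrder {q M : ℕ} (hq : q.Prime) (hM : 1 ≤ M)
    (hX : ∀ a : X, ((q ^ M : ℕ) : ℤ) • a = 0 → a = 0) {t : X} (ht : IsOfFinAddOrder t) :
    t ∈ zsmulRange X ((q ^ M : ℕ) : ℤ) := by
  set k := addOrderOf t with hk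
  have hk0 : 0 < k := ht.addOrderOf_pos
  have hkt : k • t = 0 := addOrderOf_nsmul_eq_zero t
  -- `q ∤ k`
  have hcop : Nat.Coprime q k := by
    rw [Nat.Prime.coprime_iff_not_dvd hq]
    rintro ⟨k', hk'⟩
    have hk'0 : 0 < k' := Nat.pos_of_ne_zero fun h ↦ by rw [h, mul_zero] at hk'; omega
    -- `(k/q) • t` is killed by `q`, hence by `q^M`, hence is `0`
    have hs : ((q ^ M : ℕ) : ℤ) • (k' • t) = 0 := by
      obtain ⟨M', rfl⟩ := Nat.exists_eq_add_of_le' hM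
      rw [natCast_zsmul, pow_succ, mul_smul, ← mul_smul q k' t, ← hk', hkt, smul_zero]
    have hk't : k' • t = 0 := hX _ hs
    have hdvd : k ∣ k' := addOrderOf_dvd_of_nsmul_eq_zero hk't
    have hle : k ≤ k' := Nat.le_of_dvd hk'0 hdvd
    have : q * k' ≤ 1 * k' := by rw [← hk', one_mul]; exact hle
    exact absurd (Nat.le_of_mul_le_mul_right this hk'0) (by have := hq.one_lt; omega)
  -- Bézout
  obtain ⟨u, v, huv⟩ : IsCoprime ((q ^ M : ℕ) : ℤ) (k : ℤ) :=
    Nat.isCoprime_iff_coprime.mpr (hcop.pow_left M)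
  refine ⟨u • t, ?_⟩
  change ((q ^ M : ℕ) : ℤ) • (u • t) = t
  have hkt' : (k : ℤ) • t = 0 := by rw [natCast_zsmul, hkt]
  calc ((q ^ M : ℕ) : ℤ) • (u • t) = (u * ((q ^ M : ℕ) : ℤ)) • t + v • ((k : ℤ) • t) := by
        rw [hkt', smul_zero, add_zero, mul_comm, mul_smul]
    _ = (u * ((q ^ M : ℕ) : ℤ) + v * (k : ℤ)) • t := by rw [add_smul, mul_smul v]
    _ = t := by rw [huv, one_smul]

end Torsion

/-! ## §2 The END: Gross Prop. 5.4 (1) for the concrete derived points -/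

section Main
variable {K : Type} [Field K] [NumberField K] {N : ℕ} {W : WeierstrassCurve ℚ}

/-- **Gross 1991, Prop. 5.4 (1) for the CONCRETE derived points `P(m) = (d m).derivedPoint`, at
every divisor of one Kolyvagin top level, modulo Prop. 5.3 (A′-53).**  For `K` imaginary quadratic
with `ι : K → ℂ`, `E = W/ℚ` globally minimal with a modular parametrisation `Dt` of level `N` prime
to `d_K` (`hND`), `d_K < −4` (`hD`), a prime `p`, `M ≥ 1`, a square-free level `n` whose prime
factors are Kolyvagin primes with `Frob = Frob_∞` on `K(E[p^M])` (`hKol`, Gross (3.1)–(3.3)), ANY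
Kolyvagin–Heegner data `d m` at the divisors of `n`, the non-trivial automorphism `c` of `K` and
ANY lift `τ` of `c` to `K̄` (`hτ`), `ε : ℤ` (free; printed: the `w_N`-eigenvalue of Gross (5.2),
not used), and the LABELLED inputs
* `h53` = **Gross Prop. 5.3 at conductor `m` (A′-53), printed form** (chunk 220 L11: *"We have
  `y_n^τ = ε · y_n^{σ'} +` (torsion) in `E(K_n)`, for some `σ' ∈ 𝒢_n`"*): for every `m ∣ n` and
  the automorphism `τ_m` of `K[m]` acting as complex conjugation, some `σ' ∈ 𝒢_m` has
  `τ_m y(m) − ε • σ' y(m)` of finite order — OPEN LEAF, cite-only, NOT a Literature fact, NOT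
  discharged;
* `hA` = Gross Lemma 4.3 / McCallum (5): `E(K[m]) ⊆ E(K̄)` admissible for `p^M` (`m ∣ n`);
the concrete derived point satisfies, for all `m ∣ n`:
**`∃ B ∈ E(K[m]), τ · P(m) = (ε · (−1)^{f_m}) • P(m) + p^M • B`** in `E(K̄)`, `f_m = #{ℓ ∣ m}` —
clause (d) of the `hpoints` binder of
`KolyvaginDescent.Kolyvagin1990_sha_primary_finite_of_pointsM_of_reciprocityM` read at
`A m := (d m).pointsSubgroup`, `Pt m := (d m).toGeomPoints (d m).derivedPoint`.  Proof = Gross's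
(chunk 220 L23 – 221 L7): `τ` restricts along `(d m).emb` to `τ_m · h` with `h ∈ 𝒢_m` (x11b3-p8);
`h P(m) ≡ P(m)` (McCallum (4), x11b3-p4); `τ_m P(m) ≡ ε_m P(m)` by the tree's
`KolyvaginEuler.conj_kolyvaginPoint_sub_mem` on the level data of `KolyvaginH44.exists_levelData`
(`htr` = (β2) + (3.3), x11b3-p4; `hT` ⟸ the dihedral law `τ_m σ τ_m⁻¹ = σ⁻¹`, x11b3-p4
`KolyvaginConj.exists_addMonoidHom_map_smul_eq_inv_smul`; `hτy` ⟸ `h53` + Lemma 4.3 (`hA`)); G1 seam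
(x11b3-p8).  WORDING OF RECORD: plumbing at concrete currency; CONDITIONAL on (A′-53) in printed
form (cite-only, NOT a fact) + `hA` + structural; (A′-53) / (A′-glob) / (γ) / [GZ86 III (3.1)] /
`h44` / `hpoints` / (R)_M NOT discharged; nothing booked.
[cite: GrossLMS1991, §5 Prop. 5.4 (1) and proof, Prop. 5.3, §3 (τστ⁻¹ = σ⁻¹), (3.3), §4 (4.1), Lemma 4.3]
[cite: McCallumLMS1991, §4 (4)–(5)] [cite: Cox2013, §9.A Lemma 9.3] -/
theorem pointsMap_derivedPoint_concrete_of_prop53 [NeZero N] [W.IsElliptic] [W.IsGloballyMinimal]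
    (hK : IsImaginaryQuadratic K) (ι : K →+* ℂ)
    {p M : ℕ} (hp : p.Prime) (hM : 1 ≤ M)
    (Dt : ModularParametrizationData W N) {β : ℤ}
    (hND : IsCoprime (N : ℤ) (NumberField.discr K)) (hD : NumberField.discr K < -4)
    {n : ℕ} (hn : Squarefree n)
    (hKol : ∀ q ∈ n.primeFactors, IsKolyvaginPrime N W K p q ∧ FrobEqFrobInfty W K (p ^ M) q)
    (d : (m : ℕ) → m ∣ n → KolyvaginHeegnerData Dt β ι m)
    {c : K ≃ₐ[ℚ] K} (hc : c ≠ 1) {τ : AlgebraicClosure K ≃+* AlgebraicClosure K}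
    (hτ : IsLiftOfAut c τ) (ε : ℤ)
    (h53 : ∀ (m : ℕ) (hm : m ∣ n) (τm : ringClassField K ι m ≃ₐ[ℚ] ringClassField K ι m),
      (∀ x : ringClassField K ι m, ((τm x : ringClassField K ι m) : ℂ) = starRingEnd ℂ x) →
      ∃ σ' ∈ ringClassGal ι m, IsOfFinAddOrder
        (pointGalHom W (ringClassField K ι m) τm (d m hm).y -
          ε • pointGalHom W (ringClassField K ι m) σ' (d m hm).y))
    (hA : ∀ (m : ℕ) (hm : m ∣ n),
      IsAdmissible (absoluteGaloisGroup K) (d m hm).pointsSubgroup ((p ^ M : ℕ) : ℤ)) :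
    ∀ (m : ℕ) (hm : m ∣ n), ∃ B ∈ (d m hm).pointsSubgroup,
      hτ.pointsMap W ((d m hm).toGeomPoints (d m hm).derivedPoint) =
        (ε * (-1) ^ m.primeFactors.card) • (d m hm).toGeomPoints (d m hm).derivedPoint +
          ((p ^ M : ℕ) : ℤ) • B := by
  intro m hm
  have hn0 : n ≠ 0 := Squarefree.ne_zero hn
  have hm0 : m ≠ 0 := ne_zero_of_dvd_ne_zero hn0 hm
  have hinert : ∀ q ∈ n.primeFactors, (Ideal.span {(q : 𝓞 K)}).IsPrime :=
    fun q hq ↦ (hKol q hq).1.2.2.2.2.1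
  -- THE SEAM: level data at every level (`exists_levelData`)
  choose σ H f y π j e hord hj hπρ hfsec hHρ hdict hjunk using
    fun k ↦ KolyvaginH44.exists_levelData (W := W) (Dt := Dt) (β := β) hK ι hn hinert d k
  -- `𝒢_m = ringClassGal ι m`, a finite commutative group acting on `E(K[m])` through `pointGalHom`
  letI hcg : ∀ k, CommGroup (ringClassGal ι k) := fun k ↦
    { (inferInstance : Group (ringClassGal ι k)) with
      mul_comm := fun a b ↦ (KolyvaginH44.isMulCommutative_ringClassGal' hK ι k).is_comm.comm a b }
  haveI hfin : ∀ k, Finite (ringClassGal ι k) := KolyvaginH44.finite_ringClassGal hK ι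
  letI act : ∀ k, DistribMulAction (ringClassGal ι k)
      ((W.baseChange (ringClassField K ι k)).toAffine.Point) := fun k ↦
    DistribMulAction.compHom _ ((pointGalHom W (ringClassField K ι k)).comp (ringClassGal ι k).subtype)
  letI hft : ∀ k, Fintype (ringClassGal ι k ⧸ H k) := fun k ↦ Fintype.ofFinite _
  have hsmul : ∀ (k) (g : ringClassGal ι k) (Q : (W.baseChange (ringClassField K ι k)).toAffine.Point),
      g • Q = pointGalHom W (ringClassField K ι k)
        (g : ringClassField K ι k ≃ₐ[ℚ] ringClassField K ι k) Q := fun _ _ _ ↦ rfl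
  have hmul : ∀ (a b : ringClassField K ι m ≃ₐ[ℚ] ringClassField K ι m)
      (Q : (W.baseChange (ringClassField K ι m)).toAffine.Point),
      pointGalHom W (ringClassField K ι m) (a * b) Q =
        pointGalHom W (ringClassField K ι m) a (pointGalHom W (ringClassField K ι m) b Q) :=
    fun a b Q ↦ by rw [map_mul]; rfl
  -- the inclusion `ρ_m : 𝒢_m ≤ Aut_ℚ(K[m])` (the identity `iA_m` is `AddEquiv.refl`)
  set ρ : ∀ k, ringClassGal ι k →* (ringClassField K ι k ≃ₐ[ℚ] ringClassField K ι k) :=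
    fun k ↦ (ringClassGal ι k).subtype with hρdef
  have hρ : ∀ k, Function.Injective (ρ k) := fun k ↦ (ringClassGal ι k).subtype_injective
  have hyA : ∀ (k : ℕ) (hk : k ∣ n), AddEquiv.refl _ (y k) = (d k hk).y :=
    fun k hk ↦ (hdict k hk).2.1
  have hσA : ∀ (k : ℕ) (hk : k ∣ n), ∀ q ∈ k.primeFactors, ρ k (σ k q) = (d k hk).σ q :=
    fun k hk ↦ (hdict k hk).2.2.1
  -- the abstract Kolyvagin point IS `P(m)` (x11b3-p8's G1), inside `E(K[m])`
  have hPE : kolyvaginPoint (σ m) m.primeFactors (f m) (y m) = (d m hm).derivedPoint := by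
    obtain ⟨-, hym, hσm, hfS⟩ := hdict m hm
    have hbij := KolyvaginH37Bridge.bijOn_of_section_of_transversal (ρ m) (hρ m)
      (H := H m) (Γ := ringClassGal ι m) (G₁ := ringClassGalOver ι m 1) (hHρ m)
      (S := ((d m hm).S : Set _)) (fun s hs ↦ (d m hm).S_subset s hs)
      (fun s hs ↦ ⟨⟨s, (d m hm).S_subset s hs⟩, rfl⟩) (d m hm).S_transversal (f m) (hfsec m) hfS
    have h := KolyvaginH37Bridge.map_kolyvaginPoint_eq_derivedPoint
      (pointGalHom W (ringClassField K ι m)) (ρ m) (AddMonoidHom.id _) (fun g a ↦ hsmul m g a)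
      (hn.squarefree_of_dvd hm) hσm (f m) hbij (y m)
    rw [AddMonoidHom.id_apply, AddMonoidHom.id_apply, hym] at h
    rw [hym]
    exact h
  -- McCallum's (4): `γ P(m) − P(m) ∈ p^M E(K[m])` for `γ ∈ 𝒢_m` (x11b3-p4)
  have h4 : ∀ γ : ringClassGal ι m,
      γ • kolyvaginPoint (σ m) m.primeFactors (f m) (y m) -
          kolyvaginPoint (σ m) m.primeFactors (f m) (y m) ∈
        zsmulRange ((W.baseChange (ringClassField K ι m)).toAffine.Point) ((p ^ M : ℕ) : ℤ) :=
    KolyvaginH44.smul_kolyvaginPoint_sub_mem_of_dvd hK ι Dt hp hM hND hD hn hKol d σ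
      (fun k ↦ k.primeFactors) H f y ρ hρ (fun _ ↦ AddEquiv.refl _)
      (fun k _ g a ↦ hsmul k g a) hyA hσA (fun _ _ ↦ rfl) (fun k _ ↦ hfsec k) (fun k _ ↦ hHρ k)
      m hm
  -- the Euler hypotheses of Prop. 5.4 (1) at level `m`
  have hgen : H m ≤ Subgroup.closure (σ m '' (m.primeFactors : Set ℕ)) :=
    KolyvaginH44.le_closure_of_dvd hK ι Dt hn d σ (fun k ↦ k.primeFactors) H ρ hρ hσA
      (fun _ _ ↦ rfl) (fun k _ ↦ hHρ k) m hm
  have hdvd : ∀ ℓ ∈ m.primeFactors, ((p ^ M : ℕ) : ℤ) ∣ ((ℓ + 1 : ℕ) : ℤ) := by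
    intro ℓ hℓ
    obtain ⟨hℓK, hℓM⟩ := hKol ℓ (Nat.primeFactors_mono hm hn0 hℓ)
    exact (IsKolyvaginPrime.pow_dvd_add_one W hp hℓK hM hℓM).1
  have htr : ∀ ℓ ∈ m.primeFactors,
      grAct ((W.baseChange (ringClassField K ι m)).toAffine.Point) (traceElt (σ m ℓ) ℓ) (y m) ∈
        zsmulRange ((W.baseChange (ringClassField K ι m)).toAffine.Point) ((p ^ M : ℕ) : ℤ) :=
    KolyvaginH44.grAct_traceElt_mem_of_dvd hK ι Dt hp hM hND hD hn hKol d σ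
      (fun k ↦ k.primeFactors) y ρ (fun _ ↦ AddEquiv.refl _) (fun k _ g a ↦ hsmul k g a) hyA hσA
      (fun _ _ ↦ rfl) m hm
  -- the conjugation automorphism `τ_m` of `K[m]` and the restriction `τ|K[m] = τ_m · h` (x11b3-p8)
  obtain ⟨τm, hτm⟩ := RingClassConj.exists_conj_algEquiv hK ι hm0
  have hτm𝒢 : τm ∉ ringClassGal ι m := RingClassConj.conj_not_mem_ringClassGal hτm hK
  obtain ⟨h, hh𝒢, hres⟩ :=
    RingClassConj.exists_mem_ringClassGal_apply_emb_eq hK hm0 (d m hm) hc hτ hτm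
  -- no `p^M`-torsion in `E(K[m])` (Lemma 4.3, from `hA` along the injective `toGeomPoints`)
  have hX : ∀ a : (W.baseChange (ringClassField K ι m)).toAffine.Point,
      ((p ^ M : ℕ) : ℤ) • a = 0 → a = 0 := by
    intro a ha
    have h0 : (d m hm).toGeomPoints a = 0 := by
      refine (hA m hm).eq_zero_of_zsmul ⟨a, rfl⟩ ?_
      rw [← map_zsmul (d m hm).toGeomPoints, ha, map_zero]
    have h0' : WeierstrassCurve.Affine.Point.map (W' := W) (d m hm).emb.toRatAlgHom a =
        WeierstrassCurve.Affine.Point.map (W' := W) (d m hm).emb.toRatAlgHom 0 := by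
      rw [map_zero]
      exact h0
    exact WeierstrassCurve.Affine.Point.map_injective (W' := W) (d m hm).emb.toRatAlgHom h0'
  -- `T := τ_m` on `E(K[m])` with `hT : T (γ • a) = γ⁻¹ • T a` ⟸ the dihedral law `τ_m γ τ_m⁻¹ = γ⁻¹`
  -- (Gross §3 / §5; x11b3-p4's `KolyvaginConj.exists_addMonoidHom_map_smul_eq_inv_smul`, BY NAME)
  obtain ⟨T, hTapp', hT⟩ := KolyvaginConj.exists_addMonoidHom_map_smul_eq_inv_smul hK hm0 W (ρ m)
    (fun g ↦ g.2) (AddEquiv.refl _) (fun g a ↦ hsmul m g a) hτm𝒢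
  have hTapp : ∀ P, T P = pointGalHom W (ringClassField K ι m) τm P := fun P ↦ hTapp' P
  -- Prop. 5.3 (A′-53) ⟹ `hτy` in `p^M E(K[m])` currency
  obtain ⟨σ', hσ'𝒢, hford⟩ := h53 m hm τm hτm
  have hτy : T (y m) - ε • (⟨σ', hσ'𝒢⟩ : ringClassGal ι m) • y m ∈
      zsmulRange ((W.baseChange (ringClassField K ι m)).toAffine.Point) ((p ^ M : ℕ) : ℤ) := by
    have hy : y m = (d m hm).y := (hdict m hm).2.1
    rw [hsmul, hTapp, hy]
    exact mem_zsmulRange_of_isOfFinAddOrder hp hM hX hford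
  -- Prop. 5.4 (1), abstract: `τ_m P(m) − ε_m P(m) ∈ p^M E(K[m])`
  have h54 : T (kolyvaginPoint (σ m) m.primeFactors (f m) (y m)) -
        (ε * (-1) ^ m.primeFactors.card) • kolyvaginPoint (σ m) m.primeFactors (f m) (y m) ∈
      zsmulRange ((W.baseChange (ringClassField K ι m)).toAffine.Point) ((p ^ M : ℕ) : ℤ) :=
    conj_kolyvaginPoint_sub_mem (hfsec m) hgen (fun ℓ hℓ ↦ hord m ℓ hℓ) hdvd htr T hT hτy
  -- assemble: `τ · P(m) = (τ_m h) P(m) = τ_m (P(m) + p^M a₁) = ε_m P(m) + p^M (a₂ + τ_m a₁)`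
  obtain ⟨a₁, ha₁⟩ := h4 ⟨h, hh𝒢⟩
  obtain ⟨a₂, ha₂⟩ := h54
  change ((p ^ M : ℕ) : ℤ) • a₁ =
    pointGalHom W (ringClassField K ι m) h (kolyvaginPoint (σ m) m.primeFactors (f m) (y m)) -
      kolyvaginPoint (σ m) m.primeFactors (f m) (y m) at ha₁
  change ((p ^ M : ℕ) : ℤ) • a₂ = _ at ha₂
  rw [hPE] at ha₁ ha₂
  have hg : ∀ x, τ ((d m hm).emb x) = (d m hm).emb ((τm * h) x) := fun x ↦ by
    rw [AlgEquiv.mul_apply]; exact hres x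
  have hmap := RingClassConj.pointsMap_toGeomPoints_eq (d m hm) hτ hg (d m hm).derivedPoint
  refine ⟨(d m hm).toGeomPoints (a₂ + T a₁), ⟨a₂ + T a₁, rfl⟩, ?_⟩
  have hstep : pointGalHom W (ringClassField K ι m) (τm * h) (d m hm).derivedPoint =
      (ε * (-1) ^ m.primeFactors.card) • (d m hm).derivedPoint + ((p ^ M : ℕ) : ℤ) • (a₂ + T a₁) := by
    have h1 : pointGalHom W (ringClassField K ι m) h (d m hm).derivedPoint =
        (d m hm).derivedPoint + ((p ^ M : ℕ) : ℤ) • a₁ := by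
      rw [ha₁]; abel
    have h2 : T (d m hm).derivedPoint =
        (ε * (-1) ^ m.primeFactors.card) • (d m hm).derivedPoint + ((p ^ M : ℕ) : ℤ) • a₂ := by
      rw [ha₂]; abel
    rw [hmul, h1, ← hTapp, map_add, map_zsmul, h2, smul_add]
    abel
  rw [hmap, hstep, map_add, map_zsmul, map_zsmul]

/-- **Gross Prop. 5.4 (1) for the concrete derived points ON THE SURJECTIVE CELL** (`ρ̄_{E,p}` onto,
`p` odd): as `pointsMap_derivedPoint_concrete_of_prop53`, with the admissibility binder `hA`
SUPPLIED by x11b3-p3's `RingClassNoTorsion.isAdmissible_pointsSubgroup_of_dvd` (Lemma 4.3 at the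
ring class fields `K[m]`, `m ∣ n`) — the image cell on which the tree's finiteness assembly
(binder `_hρ`) consumes `hpoints`.  Remaining labelled input exactly {`h53` = (A′-53) printed form,
cite-only, NOT a fact} + the class binder `hρ` + structural; nothing discharged on the residual map;
nothing booked. [cite: GrossLMS1991, §5 Prop. 5.4 (1), Prop. 5.3, Lemma 4.3]
[cite: McCallumLMS1991, §4 (4)–(5)] -/
theorem pointsMap_derivedPoint_concrete_of_prop53_of_surj [NeZero N] [W.IsElliptic]
    [W.IsGloballyMinimal] (hK : IsImaginaryQuadratic K) (ι : K →+* ℂ)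
    {p M : ℕ} (hp : p.Prime) (hp2 : p ≠ 2) (hρ : W.HasSurjectiveModNGaloisRep p) (hM : 1 ≤ M)
    (Dt : ModularParametrizationData W N) {β : ℤ}
    (hND : IsCoprime (N : ℤ) (NumberField.discr K)) (hD : NumberField.discr K < -4)
    {n : ℕ} (hn : Squarefree n)
    (hKol : ∀ q ∈ n.primeFactors, IsKolyvaginPrime N W K p q ∧ FrobEqFrobInfty W K (p ^ M) q)
    (d : (m : ℕ) → m ∣ n → KolyvaginHeegnerData Dt β ι m)
    {c : K ≃ₐ[ℚ] K} (hc : c ≠ 1) {τ : AlgebraicClosure K ≃+* AlgebraicClosure K}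
    (hτ : IsLiftOfAut c τ) (ε : ℤ)
    (h53 : ∀ (m : ℕ) (hm : m ∣ n) (τm : ringClassField K ι m ≃ₐ[ℚ] ringClassField K ι m),
      (∀ x : ringClassField K ι m, ((τm x : ringClassField K ι m) : ℂ) = starRingEnd ℂ x) →
      ∃ σ' ∈ ringClassGal ι m, IsOfFinAddOrder
        (pointGalHom W (ringClassField K ι m) τm (d m hm).y -
          ε • pointGalHom W (ringClassField K ι m) σ' (d m hm).y)) :
    ∀ (m : ℕ) (hm : m ∣ n), ∃ B ∈ (d m hm).pointsSubgroup,
      hτ.pointsMap W ((d m hm).toGeomPoints (d m hm).derivedPoint) =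
        (ε * (-1) ^ m.primeFactors.card) • (d m hm).toGeomPoints (d m hm).derivedPoint +
          ((p ^ M : ℕ) : ℤ) • B :=
  pointsMap_derivedPoint_concrete_of_prop53 hK ι hp hM Dt hND hD hn hKol d hc hτ ε h53
    (fun m hm ↦ RingClassNoTorsion.isAdmissible_pointsSubgroup_of_dvd hK
      (Squarefree.ne_zero hn) d hp hp2 hρ M m hm)

end Main

end Summit.BirchSwinnertonDyer.Rank1Residual.X11b.KolyvaginTauEigen

end
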